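import Summits.ValiantsHypothesis.ValiantsHypothesis.Theorems.KPlusLogSqLawTropicalBToeplitzAdditive

/-!
# Route `KPlusLogSqLaw`, crux `TropicalB` — Toeplitz sector: the first EXACT rows of Conjecture T's table, `Φ_Toep(3) = 4` and `Φ_Toep(4) = 8`

HONEST FRAMING.  Helper toward the registered stubs `stub_tropThin` / `stub_tropFat` of
`Cruxes/TropicalB/Lines/birth.lean` (crux `Summit.ValiantsHypothesis.ValiantsHypothesis.Theses.KPlusLogSqLaw.TropicalB`,
ledger item `stmt-ValiantsHypothesis-19771`, route `KPlusLogSqLaw`; cell `pub-symmetroid`, seat `val-sym-trop-p3`,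
2026-08-26).  KERNEL ROWS of the cell's Conjecture T table (`Toeplitz.LinearInstanceBound m Φ` = «`Φ_Toep(m) ≤ Φ`», the
hypothesis of `toeplitz_chain_le_of_linearBound`, all admissible sets `P` included): the first UPPER bounds in the kernel and
the first two EXACT values.  Conjecture T itself (`O(m)` / polynomial) is OPEN; nothing here bears on `TropicalB` for general
designs, `KPlusLogSqLaw`, `MatrixDescartes` or `VP ≠ VNP`.

THE RESULTS.
* `not_all_members_of_additive` — four permutations `s₁, s₂, s₃, s₄` with `{s₁, s₂} ∩ {s₃, s₄} = ∅` and the profile relation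
  `N(s₁) + N(s₂) = N(s₃) + N(s₄)` are never all members of one chain (`chain_profile_additive_free`, `…ToeplitzAdditive`).
* `m = 3`: `U(3) = 4` unshared profiles (`decide`) and an explicit instance with `4` unique optima ⇒
  **`linearInstanceBound_three_iff : LinearInstanceBound 3 Φ ↔ 4 ≤ Φ`** (`Φ_Toep(3) = 4`).
* `m = 4`: `U(4) = 9`, but the four unshared-profile permutations `1032, 3210, 1230, 3012` satisfy
  `N(1032) + N(3210) = N(1230) + N(3012)`, so a chain misses one of them: `Φ_Toep(4) ≤ 8`; an explicit instance with `8` unique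
  optima (`ψ = (4,5,0,5,3,3,4)`, `α = 2·(36,18,−14,5,32,38,23)` on `δ = −3..3`) ⇒
  **`linearInstanceBound_four_iff : LinearInstanceBound 4 Φ ↔ 8 ≤ Φ`** (`Φ_Toep(4) = 8 = 5·4 − 12`, the located law's value;
  the first size at which the shadow count is strictly below the profile count).
* (`m = 5` — `13 ≤ Φ_Toep(5) ≤ 17` — is the sibling file `…ToeplitzFive`.)
Certificates: unique optimality of each member is a `decide` over all permutations (sizes `3!`, `4!`).

References: folklore (strict complementary slackness / direct comparison); `…ToeplitzAdditive` (this seat);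
located data `HOME/val-sym-trop-p3/g3/` (instances), method memo CONJT-METHOD-g22 §1 (table: `Φ_Toep(3) = 4`, located 8, 13).
-/

set_option linter.dupNamespace false
set_option autoImplicit false

namespace Summit.ValiantsHypothesis.ValiantsHypothesis.Theorems.KPlusLogSqLaw.Toeplitz

open scoped BigOperators
open Finset

section Members

variable {m N : ℕ}

/-- **An additive quadruple is never entirely inside a chain.**  If `s₁, s₂, s₃, s₄` are permutations with `s₁, s₂ ∉ {s₃, s₄}`
and `N(s₁) + N(s₂) = N(s₃) + N(s₄)` (displacement profiles), then along any chain of pairwise distinct admissible unique optima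
at strictly increasing slopes they are not all members. [folklore] -/
theorem not_all_members_of_additive (ψ α : ℤ → ℤ) (P : ℤ → Prop) (θ' : Fin (N + 1) → ℤ)
    (τ : Fin (N + 1) → Equiv.Perm (Fin m)) (hθ : StrictMono θ') (hinj : Function.Injective τ)
    (hτP : ∀ k b, P ((τ k b : ℤ) - b))
    (huniq : ∀ k (σ : Equiv.Perm (Fin m)), σ ≠ τ k → (∀ b, P ((σ b : ℤ) - b)) →
      ∑ b, (θ' k * ψ ((σ b : ℤ) - b) + α ((σ b : ℤ) - b)) <
        ∑ b, (θ' k * ψ ((τ k b : ℤ) - b) + α ((τ k b : ℤ) - b)))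
    (s₁ s₂ s₃ s₄ : Equiv.Perm (Fin m)) (h13 : s₁ ≠ s₃) (h14 : s₁ ≠ s₄) (h23 : s₂ ≠ s₃) (h24 : s₂ ≠ s₄)
    (hrel : (univ.val.map fun i : Fin m => (s₁ i : ℤ) - i) + (univ.val.map fun i : Fin m => (s₂ i : ℤ) - i) =
      (univ.val.map fun i : Fin m => (s₃ i : ℤ) - i) + (univ.val.map fun i : Fin m => (s₄ i : ℤ) - i))
    {a b c d : Fin (N + 1)} (ha : τ a = s₁) (hb : τ b = s₂) (hc : τ c = s₃) (hd : τ d = s₄) : False := by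
  have hac : a ≠ c := fun e => h13 (by rw [← ha, ← hc, e])
  have had : a ≠ d := fun e => h14 (by rw [← ha, ← hd, e])
  have hbc : b ≠ c := fun e => h23 (by rw [← hb, ← hc, e])
  have hbd : b ≠ d := fun e => h24 (by rw [← hb, ← hd, e])
  refine chain_profile_additive_free ψ α P θ' τ hθ hinj hτP huniq hac had hbc hbd ?_
  rw [ha, hb, hc, hd]
  exact hrel

/-- members have unshared profiles: the image of a chain lies in the unshared-profile filter. [folklore] -/
theorem image_subset_unshared [DecidablePred fun σ : Equiv.Perm (Fin m) => ∀ σ' : Equiv.Perm (Fin m),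
      (univ.val.map fun b : Fin m => (σ' b : ℤ) - b) = (univ.val.map fun b : Fin m => (σ b : ℤ) - b) → σ' = σ]
    (ψ α : ℤ → ℤ) (P : ℤ → Prop) (θ' : Fin (N + 1) → ℤ)
    (τ : Fin (N + 1) → Equiv.Perm (Fin m)) (hτP : ∀ k b, P ((τ k b : ℤ) - b))
    (huniq : ∀ k (σ : Equiv.Perm (Fin m)), σ ≠ τ k → (∀ b, P ((σ b : ℤ) - b)) →
      ∑ b, (θ' k * ψ ((σ b : ℤ) - b) + α ((σ b : ℤ) - b)) <
        ∑ b, (θ' k * ψ ((τ k b : ℤ) - b) + α ((τ k b : ℤ) - b))) :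
    univ.image τ ⊆ univ.filter fun σ : Equiv.Perm (Fin m) => ∀ σ' : Equiv.Perm (Fin m),
      (univ.val.map fun b : Fin m => (σ' b : ℤ) - b) = (univ.val.map fun b : Fin m => (σ b : ℤ) - b) → σ' = σ := by
  intro σ hσ
  obtain ⟨k, _, rfl⟩ := mem_image.mp hσ
  exact mem_filter.mpr ⟨mem_univ _, fun σ' h => opt_eq_of_profile_eq ψ α P (θ' k) (τ k) σ' (hτP k) (huniq k) h⟩

end Members

/-! ## `m = 3`: `Φ_Toep(3) = 4` -/

section Three

/-- `U(3) = 4`: four permutations of `Fin 3` have an unshared displacement profile (`decide`). -/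
theorem card_unshared_three :
    (univ.filter fun σ : Equiv.Perm (Fin 3) => ∀ σ' : Equiv.Perm (Fin 3),
      (univ.val.map fun b : Fin 3 => (σ' b : ℤ) - b) = (univ.val.map fun b : Fin 3 => (σ b : ℤ) - b) → σ' = σ).card = 4 := by
  decide

/-- **`Φ_Toep(3) ≤ 4`.** -/
theorem linearInstanceBound_three : LinearInstanceBound 3 4 := by
  intro ψ α P N θ' τ hθ hinj hτP huniq
  have h := chain_le_card_unsharedProfiles ψ α P θ' τ hinj hτP huniq _ (fun σ hσ => mem_filter.mpr ⟨mem_univ _, hσ⟩)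
  rwa [card_unshared_three] at h

/-- **`Φ_Toep(3) ≥ 4`: an explicit instance with `4` unique optima** (`ψ = (0,0,1,0,1)`, `α = (0,0,−2,2,4)` on `δ = −2..2`;
members `120, 201, 210, 012` at slopes `−3, 1, 3, 11`). [folklore] -/
theorem three_chain_4 :
    ∃ (ψ α : ℤ → ℤ) (θ' : Fin 4 → ℤ) (τ : Fin 4 → Equiv.Perm (Fin 3)),
      StrictMono θ' ∧ Function.Injective τ ∧
      ∀ k (σ : Equiv.Perm (Fin 3)), σ ≠ τ k →
        ∑ b, (θ' k * ψ ((σ b : ℤ) - b) + α ((σ b : ℤ) - b)) <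
          ∑ b, (θ' k * ψ ((τ k b : ℤ) - b) + α ((τ k b : ℤ) - b)) := by
  -- instance: ψ = [0, 0, 1, 0, 1] , α = [0, 0, -2, 2, 4] on δ = -2..2; chain ['120', '201', '210', '012'] at θ = [-3, 1, 3, 11]
  let ψᵢ : ℤ → ℤ := fun δ : ℤ => if δ = -2 then 0 else if δ = -1 then 0 else if δ = 0 then 1 else if δ = 1 then 0 else if δ = 2 then 1 else 0
  let αᵢ : ℤ → ℤ := fun δ : ℤ => if δ = -2 then 0 else if δ = -1 then 0 else if δ = 0 then -2 else if δ = 1 then 2 else if δ = 2 then 4 else 0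
  let τ0 : Equiv.Perm (Fin 3) := (⟨![1, 2, 0], ![2, 0, 1], by decide, by decide⟩ : Equiv.Perm (Fin 3))
  let τ1 : Equiv.Perm (Fin 3) := (⟨![2, 0, 1], ![1, 2, 0], by decide, by decide⟩ : Equiv.Perm (Fin 3))
  let τ2 : Equiv.Perm (Fin 3) := (⟨![2, 1, 0], ![2, 1, 0], by decide, by decide⟩ : Equiv.Perm (Fin 3))
  let τ3 : Equiv.Perm (Fin 3) := (⟨![0, 1, 2], ![0, 1, 2], by decide, by decide⟩ : Equiv.Perm (Fin 3))
  let θs : Fin 4 → ℤ := ![-3, 1, 3, 11]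
  let τs : Fin 4 → Equiv.Perm (Fin 3) := ![τ0, τ1, τ2, τ3]
  have h0 : ∀ σ : Equiv.Perm (Fin 3), σ ≠ τ0 →
      ∑ b, ((-3 : ℤ) * ψᵢ ((σ b : ℤ) - b) + αᵢ ((σ b : ℤ) - b)) < ∑ b, ((-3 : ℤ) * ψᵢ ((τ0 b : ℤ) - b) + αᵢ ((τ0 b : ℤ) - b)) := by
    decide
  have h1 : ∀ σ : Equiv.Perm (Fin 3), σ ≠ τ1 →
      ∑ b, ((1 : ℤ) * ψᵢ ((σ b : ℤ) - b) + αᵢ ((σ b : ℤ) - b)) < ∑ b, ((1 : ℤ) * ψᵢ ((τ1 b : ℤ) - b) + αᵢ ((τ1 b : ℤ) - b)) := by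
    decide
  have h2 : ∀ σ : Equiv.Perm (Fin 3), σ ≠ τ2 →
      ∑ b, ((3 : ℤ) * ψᵢ ((σ b : ℤ) - b) + αᵢ ((σ b : ℤ) - b)) < ∑ b, ((3 : ℤ) * ψᵢ ((τ2 b : ℤ) - b) + αᵢ ((τ2 b : ℤ) - b)) := by
    decide
  have h3 : ∀ σ : Equiv.Perm (Fin 3), σ ≠ τ3 →
      ∑ b, ((11 : ℤ) * ψᵢ ((σ b : ℤ) - b) + αᵢ ((σ b : ℤ) - b)) < ∑ b, ((11 : ℤ) * ψᵢ ((τ3 b : ℤ) - b) + αᵢ ((τ3 b : ℤ) - b)) := by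
    decide
  refine ⟨ψᵢ, αᵢ, θs, τs, Fin.strictMono_iff_lt_succ.mpr (by decide), by decide, fun k => ?_⟩
  fin_cases k
  · exact h0
  · exact h1
  · exact h2
  · exact h3

/-- `Φ_Toep(3) > 3`. -/
theorem not_linearInstanceBound_three_3 : ¬ LinearInstanceBound 3 3 := by
  intro h
  obtain ⟨ψ, α, θ', τ, hθ, hτ, hu⟩ := three_chain_4
  have := h ψ α (fun _ => True) 3 θ' τ hθ hτ (fun _ _ => trivial) (fun k σ hσ _ => hu k σ hσ)
  omega

/-- **EXACT ROW `Φ_Toep(3) = 4`.** -/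
theorem linearInstanceBound_three_iff (Φ : ℕ) : LinearInstanceBound 3 Φ ↔ 4 ≤ Φ :=
  ⟨fun h => by
    by_contra hh
    exact not_linearInstanceBound_three_3 (h.mono (by omega)),
   fun h => linearInstanceBound_three.mono h⟩

end Three

/-! ## `m = 4`: `Φ_Toep(4) = 8 < U(4) = 9` -/

section Four

/-- `U(4) = 9` (`decide`). -/
theorem card_unshared_four :
    (univ.filter fun σ : Equiv.Perm (Fin 4) => ∀ σ' : Equiv.Perm (Fin 4),
      (univ.val.map fun b : Fin 4 => (σ' b : ℤ) - b) = (univ.val.map fun b : Fin 4 => (σ b : ℤ) - b) → σ' = σ).card = 9 := by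
  decide

/-- **`Φ_Toep(4) ≤ 8`**: a `9`-member chain would contain all nine unshared-profile permutations, among them the additive
quadruple `N(1032) + N(3210) = N(1230) + N(3012)` — impossible by `not_all_members_of_additive`. [folklore] -/
theorem linearInstanceBound_four : LinearInstanceBound 4 8 := by
  intro ψ α P N θ' τ hθ hinj hτP huniq
  have h9 := chain_le_card_unsharedProfiles ψ α P θ' τ hinj hτP huniq _ (fun σ hσ => mem_filter.mpr ⟨mem_univ _, hσ⟩)
  rw [card_unshared_four] at h9
  by_contra h8
  have hsub := image_subset_unshared ψ α P θ' τ hτP huniq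
  have hcard : (univ.image τ).card = N + 1 := by
    rw [card_image_of_injective _ hinj, card_univ, Fintype.card_fin]
  have heq : univ.image τ = _ := eq_of_subset_of_card_le hsub (by rw [card_unshared_four, hcard]; omega)
  let s₁ : Equiv.Perm (Fin 4) := ⟨![1, 0, 3, 2], ![1, 0, 3, 2], by decide, by decide⟩
  let s₂ : Equiv.Perm (Fin 4) := ⟨![3, 2, 1, 0], ![3, 2, 1, 0], by decide, by decide⟩
  let s₃ : Equiv.Perm (Fin 4) := ⟨![1, 2, 3, 0], ![3, 0, 1, 2], by decide, by decide⟩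
  let s₄ : Equiv.Perm (Fin 4) := ⟨![3, 0, 1, 2], ![1, 2, 3, 0], by decide, by decide⟩
  have m₁ : s₁ ∈ univ.image τ := by rw [heq]; decide
  have m₂ : s₂ ∈ univ.image τ := by rw [heq]; decide
  have m₃ : s₃ ∈ univ.image τ := by rw [heq]; decide
  have m₄ : s₄ ∈ univ.image τ := by rw [heq]; decide
  obtain ⟨a, -, ha⟩ := mem_image.mp m₁
  obtain ⟨b, -, hb⟩ := mem_image.mp m₂
  obtain ⟨c, -, hc⟩ := mem_image.mp m₃
  obtain ⟨d, -, hd⟩ := mem_image.mp m₄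
  exact not_all_members_of_additive ψ α P θ' τ hθ hinj hτP huniq s₁ s₂ s₃ s₄ (by decide) (by decide) (by decide) (by decide)
    (by decide) ha hb hc hd

/-- **`Φ_Toep(4) ≥ 8`: an explicit instance with `8` unique optima** (`ψ = (4,5,0,5,3,3,4)`, `α = (72,36,−28,10,64,76,46)` on
`δ = −3..3`; members `3012, 1032, 2310, 1230, 2301, 3201, 3120, 0123`). [folklore] -/
theorem four_chain_8 :
    ∃ (ψ α : ℤ → ℤ) (θ' : Fin 8 → ℤ) (τ : Fin 8 → Equiv.Perm (Fin 4)),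
      StrictMono θ' ∧ Function.Injective τ ∧
      ∀ k (σ : Equiv.Perm (Fin 4)), σ ≠ τ k →
        ∑ b, (θ' k * ψ ((σ b : ℤ) - b) + α ((σ b : ℤ) - b)) <
          ∑ b, (θ' k * ψ ((τ k b : ℤ) - b) + α ((τ k b : ℤ) - b)) := by
  -- instance: ψ = [4, 5, 0, 5, 3, 3, 4] , α = [72, 36, -28, 10, 64, 76, 46] on δ = -3..3; chain ['3012', '1032', '2310', '1230', '2301', '3201', '3120', '0123'] at θ = [-58, -54, -30, -22, 14, 43, 45, 52]
  let ψᵢ : ℤ → ℤ := fun δ : ℤ => if δ = -3 then 4 else if δ = -2 then 5 else if δ = -1 then 0 else if δ = 0 then 5 else if δ = 1 then 3 else if δ = 2 then 3 else if δ = 3 then 4 else 0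
  let αᵢ : ℤ → ℤ := fun δ : ℤ => if δ = -3 then 72 else if δ = -2 then 36 else if δ = -1 then -28 else if δ = 0 then 10 else if δ = 1 then 64 else if δ = 2 then 76 else if δ = 3 then 46 else 0
  let τ0 : Equiv.Perm (Fin 4) := (⟨![3, 0, 1, 2], ![1, 2, 3, 0], by decide, by decide⟩ : Equiv.Perm (Fin 4))
  let τ1 : Equiv.Perm (Fin 4) := (⟨![1, 0, 3, 2], ![1, 0, 3, 2], by decide, by decide⟩ : Equiv.Perm (Fin 4))
  let τ2 : Equiv.Perm (Fin 4) := (⟨![2, 3, 1, 0], ![3, 2, 0, 1], by decide, by decide⟩ : Equiv.Perm (Fin 4))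
  let τ3 : Equiv.Perm (Fin 4) := (⟨![1, 2, 3, 0], ![3, 0, 1, 2], by decide, by decide⟩ : Equiv.Perm (Fin 4))
  let τ4 : Equiv.Perm (Fin 4) := (⟨![2, 3, 0, 1], ![2, 3, 0, 1], by decide, by decide⟩ : Equiv.Perm (Fin 4))
  let τ5 : Equiv.Perm (Fin 4) := (⟨![3, 2, 0, 1], ![2, 3, 1, 0], by decide, by decide⟩ : Equiv.Perm (Fin 4))
  let τ6 : Equiv.Perm (Fin 4) := (⟨![3, 1, 2, 0], ![3, 1, 2, 0], by decide, by decide⟩ : Equiv.Perm (Fin 4))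
  let τ7 : Equiv.Perm (Fin 4) := (⟨![0, 1, 2, 3], ![0, 1, 2, 3], by decide, by decide⟩ : Equiv.Perm (Fin 4))
  let θs : Fin 8 → ℤ := ![-58, -54, -30, -22, 14, 43, 45, 52]
  let τs : Fin 8 → Equiv.Perm (Fin 4) := ![τ0, τ1, τ2, τ3, τ4, τ5, τ6, τ7]
  have h0 : ∀ σ : Equiv.Perm (Fin 4), σ ≠ τ0 →
      ∑ b, ((-58 : ℤ) * ψᵢ ((σ b : ℤ) - b) + αᵢ ((σ b : ℤ) - b)) < ∑ b, ((-58 : ℤ) * ψᵢ ((τ0 b : ℤ) - b) + αᵢ ((τ0 b : ℤ) - b)) := by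
    decide
  have h1 : ∀ σ : Equiv.Perm (Fin 4), σ ≠ τ1 →
      ∑ b, ((-54 : ℤ) * ψᵢ ((σ b : ℤ) - b) + αᵢ ((σ b : ℤ) - b)) < ∑ b, ((-54 : ℤ) * ψᵢ ((τ1 b : ℤ) - b) + αᵢ ((τ1 b : ℤ) - b)) := by
    decide
  have h2 : ∀ σ : Equiv.Perm (Fin 4), σ ≠ τ2 →
      ∑ b, ((-30 : ℤ) * ψᵢ ((σ b : ℤ) - b) + αᵢ ((σ b : ℤ) - b)) < ∑ b, ((-30 : ℤ) * ψᵢ ((τ2 b : ℤ) - b) + αᵢ ((τ2 b : ℤ) - b)) := by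
    decide
  have h3 : ∀ σ : Equiv.Perm (Fin 4), σ ≠ τ3 →
      ∑ b, ((-22 : ℤ) * ψᵢ ((σ b : ℤ) - b) + αᵢ ((σ b : ℤ) - b)) < ∑ b, ((-22 : ℤ) * ψᵢ ((τ3 b : ℤ) - b) + αᵢ ((τ3 b : ℤ) - b)) := by
    decide
  have h4 : ∀ σ : Equiv.Perm (Fin 4), σ ≠ τ4 →
      ∑ b, ((14 : ℤ) * ψᵢ ((σ b : ℤ) - b) + αᵢ ((σ b : ℤ) - b)) < ∑ b, ((14 : ℤ) * ψᵢ ((τ4 b : ℤ) - b) + αᵢ ((τ4 b : ℤ) - b)) := by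
    decide
  have h5 : ∀ σ : Equiv.Perm (Fin 4), σ ≠ τ5 →
      ∑ b, ((43 : ℤ) * ψᵢ ((σ b : ℤ) - b) + αᵢ ((σ b : ℤ) - b)) < ∑ b, ((43 : ℤ) * ψᵢ ((τ5 b : ℤ) - b) + αᵢ ((τ5 b : ℤ) - b)) := by
    decide
  have h6 : ∀ σ : Equiv.Perm (Fin 4), σ ≠ τ6 →
      ∑ b, ((45 : ℤ) * ψᵢ ((σ b : ℤ) - b) + αᵢ ((σ b : ℤ) - b)) < ∑ b, ((45 : ℤ) * ψᵢ ((τ6 b : ℤ) - b) + αᵢ ((τ6 b : ℤ) - b)) := by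
    decide
  have h7 : ∀ σ : Equiv.Perm (Fin 4), σ ≠ τ7 →
      ∑ b, ((52 : ℤ) * ψᵢ ((σ b : ℤ) - b) + αᵢ ((σ b : ℤ) - b)) < ∑ b, ((52 : ℤ) * ψᵢ ((τ7 b : ℤ) - b) + αᵢ ((τ7 b : ℤ) - b)) := by
    decide
  refine ⟨ψᵢ, αᵢ, θs, τs, Fin.strictMono_iff_lt_succ.mpr (by decide), by decide, fun k => ?_⟩
  fin_cases k
  · exact h0
  · exact h1
  · exact h2
  · exact h3
  · exact h4
  · exact h5
  · exact h6
  · exact h7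

/-- `Φ_Toep(4) > 7`. -/
theorem not_linearInstanceBound_four_7 : ¬ LinearInstanceBound 4 7 := by
  intro h
  obtain ⟨ψ, α, θ', τ, hθ, hτ, hu⟩ := four_chain_8
  have := h ψ α (fun _ => True) 7 θ' τ hθ hτ (fun _ _ => trivial) (fun k σ hσ _ => hu k σ hσ)
  omega

/-- **EXACT ROW `Φ_Toep(4) = 8`** (`= 5·4 − 12`; strictly below the profile count `U(4) = 9`). -/
theorem linearInstanceBound_four_iff (Φ : ℕ) : LinearInstanceBound 4 Φ ↔ 8 ≤ Φ :=
  ⟨fun h => by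
    by_contra hh
    exact not_linearInstanceBound_four_7 (h.mono (by omega)),
   fun h => linearInstanceBound_four.mono h⟩

end Four

/-! ## `m ≤ 2`: the trivial rows `Φ_Toep(0) = Φ_Toep(1) = 1`, `Φ_Toep(2) = 2` (appended; table complete up to `m = 4`) -/

section Two

/-- `U(2) = 2` (`decide`). -/
theorem card_unshared_two :
    (univ.filter fun σ : Equiv.Perm (Fin 2) => ∀ σ' : Equiv.Perm (Fin 2),
      (univ.val.map fun b : Fin 2 => (σ' b : ℤ) - b) = (univ.val.map fun b : Fin 2 => (σ b : ℤ) - b) → σ' = σ).card = 2 := by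
  decide

/-- **`Φ_Toep(2) ≤ 2`.** -/
theorem linearInstanceBound_two : LinearInstanceBound 2 2 := by
  intro ψ α P N θ' τ hθ hinj hτP huniq
  have h := chain_le_card_unsharedProfiles ψ α P θ' τ hinj hτP huniq _ (fun σ hσ => mem_filter.mpr ⟨mem_univ _, hσ⟩)
  rwa [card_unshared_two] at h

/-- **EXACT ROW `Φ_Toep(2) = 2`** (lower side: the two rotations, `le_of_linearInstanceBound`-style instance inlined:
`ψ = δ mod 2`, `α = −(δ mod 2)²`). -/
theorem linearInstanceBound_two_iff (Φ : ℕ) : LinearInstanceBound 2 Φ ↔ 2 ≤ Φ := by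
  refine ⟨fun h => ?_, fun h => linearInstanceBound_two.mono h⟩
  let ψᵢ : ℤ → ℤ := fun δ : ℤ => if δ = -1 then 1 else if δ = 0 then 0 else if δ = 1 then 1 else 0
  let αᵢ : ℤ → ℤ := fun δ : ℤ => if δ = -1 then -1 else if δ = 0 then 0 else if δ = 1 then -1 else 0
  let τ0 : Equiv.Perm (Fin 2) := (⟨![0, 1], ![0, 1], by decide, by decide⟩ : Equiv.Perm (Fin 2))
  let τ1 : Equiv.Perm (Fin 2) := (⟨![1, 0], ![1, 0], by decide, by decide⟩ : Equiv.Perm (Fin 2))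
  let θs : Fin 2 → ℤ := ![0, 2]
  let τs : Fin 2 → Equiv.Perm (Fin 2) := ![τ0, τ1]
  have h0 : ∀ σ : Equiv.Perm (Fin 2), σ ≠ τ0 →
      ∑ b, ((0 : ℤ) * ψᵢ ((σ b : ℤ) - b) + αᵢ ((σ b : ℤ) - b)) < ∑ b, ((0 : ℤ) * ψᵢ ((τ0 b : ℤ) - b) + αᵢ ((τ0 b : ℤ) - b)) := by
    decide
  have h1 : ∀ σ : Equiv.Perm (Fin 2), σ ≠ τ1 →
      ∑ b, ((2 : ℤ) * ψᵢ ((σ b : ℤ) - b) + αᵢ ((σ b : ℤ) - b)) < ∑ b, ((2 : ℤ) * ψᵢ ((τ1 b : ℤ) - b) + αᵢ ((τ1 b : ℤ) - b)) := by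
    decide
  have hθ : StrictMono θs := Fin.strictMono_iff_lt_succ.mpr (by decide)
  have hτ : Function.Injective τs := by decide
  refine h ψᵢ αᵢ (fun _ => True) 1 θs τs hθ hτ (fun _ _ => trivial) (fun k σ hσ _ => ?_)
  fin_cases k
  · exact h0 σ hσ
  · exact h1 σ hσ

/-- **The table up to `m = 4`**: `Φ_Toep(0) = Φ_Toep(1) = 1`, `Φ_Toep(2) = 2`, `Φ_Toep(3) = 4`, `Φ_Toep(4) = 8`
(`linearInstanceBound_zero_iff`, `…_one_iff`, `…_two_iff`, `…_three_iff`, `…_four_iff`). -/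
theorem linearInstanceBound_table_le_four (Φ : ℕ) :
    (LinearInstanceBound 0 Φ ↔ 1 ≤ Φ) ∧ (LinearInstanceBound 1 Φ ↔ 1 ≤ Φ) ∧ (LinearInstanceBound 2 Φ ↔ 2 ≤ Φ) ∧
      (LinearInstanceBound 3 Φ ↔ 4 ≤ Φ) ∧ (LinearInstanceBound 4 Φ ↔ 8 ≤ Φ) :=
  ⟨linearInstanceBound_zero_iff Φ, linearInstanceBound_one_iff Φ, linearInstanceBound_two_iff Φ,
    linearInstanceBound_three_iff Φ, linearInstanceBound_four_iff Φ⟩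

end Two

end Summit.ValiantsHypothesis.ValiantsHypothesis.Theorems.KPlusLogSqLaw.Toeplitz
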